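import Summits.BirchSwinnertonDyer.Rank1Residual.GaloisImage.CongruenceVisibilityPotMult
import Summits.BirchSwinnertonDyer.Rank1Residual.Supersingular.X7VisibilityWitnessShape
import Summits.BirchSwinnertonDyer.Rank1Residual.X11b.PadicRootsOfUnityOdd
import Summits.BirchSwinnertonDyer.Rank1Residual.Additive.X4RankZeroCoveredLocusNoLemma20
import Summits.BirchSwinnertonDyer.Rank1Residual.Additive.N10LowerHalfStatements
import Literature.NumberTheory.EllipticCurves.SelmerCorankControlRatProofs
import Literature.NumberTheory.EllipticCurves.LFunctionPrimeCoeff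
import HarnessLib

/-!
# Crux `MultLower` (item 19359), cell (M): the SELMER-COMPANION / VISIBILITY door at the ADDITIVE,
# potentially MULTIPLICATIVE prime — `ord_p #Ш(E)_an ≤ ord_p #Ш(E)` (every odd `p`) and `BSD(E,p)`
# (X4(M), `ρ̄` onto, ANY odd `p`) from a `p`-congruent partner of the same kind and ONE named rational
# point, the place `p` itself being FREE by Mazur–Rubin 2015 Thm. 3.1 (iv)(a) / §6 Case 4 = the tree's
# kind (iii′) (NO engine value, NO main conjecture, NO new named fact)

Cell `bsd-addord`, seat `bsd-addord-k1-c4` (D-0074 row B3), gen 5. HONEST FRAMING: nothing here proves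
the Birch–Swinnerton-Dyer conjecture or the crux `MultLower` (a ∀-statement over cell (M), whose
Λ-adic child `MultLambdaLower` is NOT in print — gens 0–4 of this seat); THEOREMS ONLY (no definition,
no named fact, no `sorry`); every published input is an explicit named-fact binder; every per-pair
input (the `p`-congruence `θ`, the witness point, the finite set of places and their kinds, the datum
`#Ш_an`) is a displayed binder decided OUTSIDE this file (kernel deciders exist for each: the per-pair
records of `bsd-addord-k1-c2` gen 4, `Theorems/AdditiveBranchIMCGordTwoRankZeroCompanionRecord*.lean`,
and of team n1011, `Rank1Residual/Additive/X4ThreeVisibleTateRowShape*.lean`); nothing is booked by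
this file. This module deliberately does NOT import the route file `Theses/AdditiveBranchIMC.lean`
(theses-cone lint): per-pair records import it without entering the route's rebuild cone.

## The observation (gen 5) — the (M) twin of k1-c2 gen 4's (G-ord, `e = 2`) companion door

On cell (M) (`N10.CellM`: odd `p`, additive, `ord_p j(E) < 0`) `E ≅ V^{(p*)}` with `V` MULTIPLICATIVE at
`p`, so `E` itself has POTENTIALLY MULTIPLICATIVE (additive, Kodaira `I_n^*`) reduction at `p`:
`|j(E)|_p > 1`. Mazur–Rubin, *Selmer companion curves* (Trans. AMS 367 (2015)) Thm. 3.1 allows at a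
prime `𝔭 ∣ p` EITHER (iv)(b) both curves good (k1-c2's kind (vi), the twisted named fact
`MazurRubin2015.selmerLocalKer_iff_of_twist_of_goodReduction_above`) OR **(iv)(a) `𝔭 ∈ S₁ = S₂`: both
curves potentially multiplicative at `𝔭`**, the local content being §6 Case 4 ("`v ∤ ∞` and `E₁` has
potentially multiplicative reduction at `v`" — `v ∣ p` allowed —: Lemmas 5.4 / 5.6 (i) / 5.7 (i), the
twisted Kummer map of the quadratic splitting field, `p > 2`) under hypothesis (iii) (canonical subgroups
identified; automatic by Lemma 2.5 when `p ∤ ord_v j`). THAT local statement is ALREADY A THEOREM of the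
tree, in the equivalent Silverman *ATAEC* V.5.3 / Cor. 5.4 form (`|j|_v > 1`, same twist class
`γ(E) ≡ γ(E') mod K_v^{×2}`, `μ_p(K_v) = 1`): team n1011's **kind (iii′)**
`GaloisImage.TwistedKummer.h1Equiv_mem_selmerLocalKer_of_one_lt_valuation_j`
(`Rank1Residual/GaloisImage/CongruenceVisibilityPotMult.lean`, from the general-`j` Tate uniformisation
THEOREM `AdditivePotMult.TateOfValuationJ.tateUniformisation_of_one_lt_valuation_j`; conditional only on the
registered named fact A41 = `Silverman1994_thmV53_corV54_tateUniformisation`, the binder `hU2` of every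
multiplicative-place visibility record of the tree). Team n1011 uses it at `p = 3` (road PASS-T, the 587
`X4ThreeVisibleTateRowShape*` records); at `p ≥ 5` on cell (M) — this cell's board B2 — nobody had.

So for an (M) pair `E`, and a `p`-congruent partner `E'` ALSO potentially multiplicative at `p` (the
"(M)-type partner" of k1-c2 gen 3's census kit j253895: 216 of the 542 OPEN rank-`0` X4(M) ∩ surj rows
at `p ≥ 5` have a clean rank-`2` one), the additive place `p` is FREE as soon as `γ(E)/γ(E')` is a
square in `ℚ_p` (`γ = −c₄/c₆`; both `V`, `V'` split or both non-split at `p` — a Legendre symbol on the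
unit part, kernel-decidable by `GaloisImage.PadicTwistClassDecider.exists_eq_sq_mul_of_sqFlagAt`), since
`μ_p(ℚ_p) = 1` for odd `p` (`X11b.CongruentTransfer.adicCompletion_rat_pow_eq_one_imp_eq_one_above`).
Then team b2b's WITNESS ROAD (`Supersingular/X7VisibilityWitnessShape.lean`, team n1011's
`VisibleWitness.exists_sha_ne_zero_of_congr_of_witness`): NAME a point `P ∈ E'(ℚ) ∖ pE'(ℚ)` whose
transported Kummer class is Selmer for `E` at every bad place ⇒ `Ш(E)[p] ≠ 0` ⇒ (Cassels–Tate)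
`p² ∣ #Ш(E)` ⇒ `ord_p #Ш(E)_an ≤ ord_p #Ш(E)` whenever `ord_p #Ш(E)_an ≤ 2` = `MissingLowerBoundAt W p` —
the crux's conclusion AT THE PAIR, for EVERY odd `p`, with NO Iwasawa theory and NO engine value; and on
X4(M) ∩ surj(p) ∩ `r_an = 0` the UPPER half is team n1011's `ClassX4M.bsdp_rankZero_of_surj_of_lower_noL20`
(Delbourgo 1998 Prop. 4 + Kato's half-eigen divisibility read on the `ω^{(p−1)/2}`-component, ANY odd
`p`), whence `BSDp W p`. Compared with this seat's gen-3 budget road (`…MultLowerBudget.lean`: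
EPW + RANK-partner + ONE ENGINE VALUE `CERT(E)@b`, engine 1 infeasible above `N₀ ≈ 2·10⁴`) the door needs
no engine value and does not see `λ`.

## What (class-free; `W` = the target, `W'` = the partner)

* §0 kind (iii′) at the place of `p` over `ℚ` in prime-indexed form: both `ord_p j < 0` + the square class
  ⇒ `θ_* 𝓢_v(W') ≤ 𝓢_v(W)` (`hU2` only).
* §1 local dispatch at a place `w ∈ S` for the transported Kummer class of `P ∈ W'(ℚ)`: (a) `P` has a
  `p`-th root in `W'(ℚ_w)`; (i) `w ∤ p`, `W'(ℚ_w)[p] = 0`; (ii) both split multiplicative, `#W(ℚ_w)[p] ≤ p`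
  (`hU`); (iii) both multiplicative, same `γ`-class, `μ_p(ℚ_w) = 1` (`hU2`); (iv) one non-split
  multiplicative, the other good (Fisher 2016 Thm. 4.4, `hF44`); **(iii′) `|j(W)|_w > 1`, `|j(W')|_w > 1`,
  same `γ`-class, `μ_p(ℚ_w) = 1`** (`hU2`; `w ∣ p` allowed); and the LEAN variant (a)/(i)/(iii′) (`hU2` alone).
* §2 `Ш(W)[p] ≠ 0` from a named witness (`W(ℚ)` finite of order prime to `p`), six-option and lean forms.
* the DOORS (`MissingLowerBoundAt W p` for any `W` with `E[p]` irreducible, `r_an = 0`, `ord_p #Ш_an ≤ 2`,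
  every odd `p`; the cell-(M) form; `BSDp W p` on X4(M) ∩ surj(p), ANY odd `p`) are in the sibling file
  `AdditiveBranchIMCMultLowerCompanionDoors.lean` (same gen; the 400-line rule).

HONEST PRICE. The door bites on a pair only if a `p`-congruent curve of positive rank, potentially
multiplicative at `p` of the same twist class, with compatible bad places exists (per-pair search +
certificate, EVIDENCE outside the kernel until a record lands); it says nothing class-wide: the crux and
its child `MultLambdaLower` stay OPEN.

References: Mazur–Rubin 2015 Thm. 3.1 (iv)(a), Lemma 2.5, §5.2, §6 Case 4 [MazurRubin2015SelmerCompanions];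
Silverman ATAEC V.5.2–5.4 [SilvermanATAEC1994]; Cremona–Mazur 2000 §3 [CremonaMazur2000]; Agashe–Stein 2002
Lemma 3.6 [AgasheStein2002]; Fisher 2016 Thm. 4.4 [Fisher2016Visualizing7]; Silverman AEC X.4.14
[SilvermanAEC2009]; Kato 2004 Thm. 17.4 (3) [Kato2004Asterisque]; Delbourgo 1998 Prop. 4 [Delbourgo1998];
Wuthrich 2014 Thm. 3 / Cor. 19 [Wuthrich2014]; Miller 2011 Def. 1.1 [Miller2011LMS]; Cassels 1986 Ch. 6
[Cassels1986].
-/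

set_option autoImplicit false

noncomputable section

open scoped Classical

open WeierstrassCurve Literature.NumberTheory.EllipticCurves
  Literature.NumberTheory.EllipticCurves.Rank1Residual
  Literature.NumberTheory.EllipticCurves.Rank1Residual.Typed
  Literature.NumberTheory.EllipticCurves.Wuthrich2014
  Literature.NumberTheory.EllipticCurves.Fisher2016
  Literature.NumberTheory.GaloisRepresentations
  Summit.BirchSwinnertonDyer.Rank1Residual.GaloisImage
  Summit.BirchSwinnertonDyer.Rank1Residual.X11b.CongruentTransfer
open NumberField IsDedekindDomain Rat.HeightOneSpectrum Field
  Literature.NumberTheory.EllipticCurves.ModularForms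

set_option linter.dupNamespace false

namespace Summit.BirchSwinnertonDyer.BirchSwinnertonDyer.Theorems.AdditiveBranchIMCMultLowerCompanion

open Summit.BirchSwinnertonDyer.Rank1Residual
open Summit.BirchSwinnertonDyer.Rank1Residual.Additive
open Summit.BirchSwinnertonDyer.Rank1Residual.AdditivePotMult

/-! ## §0 Kind (iii′) at the place of `p` over `ℚ`, prime-indexed: both curves `ord_p j < 0` -/

section PlaceP

variable {W W' : WeierstrassCurve ℚ} [W.IsElliptic] [W'.IsElliptic] {p : ℕ} [hp : Fact p.Prime]

/-- **Mazur–Rubin 2015 Thm. 3.1 (iv)(a) / §6 Case 4 at the place of `p` over `ℚ`** = team n1011's kind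
(iii′) `TwistedKummer.h1Equiv_mem_selmerLocalKer_of_one_lt_valuation_j` in prime-indexed form: `p` odd,
BOTH curves potentially multiplicative at `p` (`ord_p j(W) < 0`, `ord_p j(W') < 0` — multiplicative or
additive of Kodaira type `I_n^*`), `γ(W) = r² γ(W')` in `ℚ_p` (`γ = −c₄/c₆`: same splitting character of the
Tate curve), `θ : W'[p] ⥲ W[p]` a `Γ_ℚ`-isomorphism, `v` the place of `p`: `θ_* 𝓢_v(W') ≤ 𝓢_v(W)`. The
roots-of-unity clause `μ_p(ℚ_p) = 1` is automatic for odd `p`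
(`X11b.CongruentTransfer.adicCompletion_rat_pow_eq_one_imp_eq_one_above`). Conditional on A41 `hU2` (Tate
uniformisation, Silverman ATAEC V.5.3/Cor. 5.4; the general-`j` form is a THEOREM of the tree).
[cite: MazurRubin2015SelmerCompanions, Thm. 3.1 (iv)(a) and §6 proof Case 4]
[cite: SilvermanATAEC1994, Ch. V Lemma 5.2 (c), Thm. 5.3, Cor. 5.4] [cite: Cassels1986, Ch. 6] -/
theorem selmerLocalKer_le_of_potMult_above
    (hU2 : Silverman1994_thmV53_corV54_tateUniformisation.{0}) (hp2 : p ≠ 2)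
    (θ : geomTorsion W' (p : ℤ) ≃+ geomTorsion W (p : ℤ))
    (hθ : ∀ (σ : absoluteGaloisGroup ℚ) (P : geomTorsion W' (p : ℤ)), θ (σ • P) = σ • θ P)
    (v : HeightOneSpectrum (𝓞 ℚ)) (hv : (p : 𝓞 ℚ) ∈ v.asIdeal)
    (hj : padicValRat p W.j < 0) (hj' : padicValRat p W'.j < 0)
    (hγ : ∃ r : v.adicCompletion ℚ, algebraMap ℚ (v.adicCompletion ℚ) (-(W.c₄ / W.c₆)) =
      r ^ 2 * algebraMap ℚ (v.adicCompletion ℚ) (-(W'.c₄ / W'.c₆)))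
    {c : galH1Torsion W' (p : ℤ)} (hc : c ∈ selmerLocalKer W' (v.adicCompletion ℚ) (p : ℤ)) :
    h1Equiv θ hθ c ∈ selmerLocalKer W (v.adicCompletion ℚ) (p : ℤ) := by
  have hpv : (primesEquiv v : ℕ) = p := primesEquiv_eq_of_natCast_mem v hp.out hv
  have hjW0 : W.j ≠ 0 := fun h ↦ by rw [h, padicValRat.zero] at hj; exact lt_irrefl _ hj
  have hjW'0 : W'.j ≠ 0 := fun h ↦ by rw [h, padicValRat.zero] at hj'; exact lt_irrefl _ hj'
  have hWj : 1 < v.valuation ℚ W.j := (TwistedKummer.one_lt_valuation_iff_padicValRat_neg v hpv hjW0).mpr hj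
  have hW'j : 1 < v.valuation ℚ W'.j :=
    (TwistedKummer.one_lt_valuation_iff_padicValRat_neg v hpv hjW'0).mpr hj'
  have hμ : ∀ ζ : v.adicCompletion ℚ, ζ ^ p = 1 → ζ = 1 :=
    adicCompletion_rat_pow_eq_one_imp_eq_one_above hp2 v hpv
  exact TwistedKummer.h1Equiv_mem_selmerLocalKer_of_one_lt_valuation_j W v hU2 hp2 W' θ hθ hWj hW'j hγ hμ hc

end PlaceP

/-! ## §1 Local dispatch for the transported Kummer class of a rational point of the partner -/

section Witness

variable {W W' : WeierstrassCurve ℚ} [W.IsElliptic] [W'.IsElliptic] {p : ℕ} [hp : Fact p.Prime]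

/-- Local dispatch (six options, kind (iii′) among them): at a place `w ∈ S`, the transported Kummer class
`θ_* κ'(P)` of `P ∈ W'(ℚ)` satisfies the local condition of `W` if EITHER (a) `P|_{ℚ_w}` has a `p`-th root in
`W'(ℚ_w)` OR `w` is of one of the free kinds (i) `w ∤ p`, `W'(ℚ_w)[p] = 0`; (ii) both split multiplicative,
`#W(ℚ_w)[p] ≤ p`; (iii) both multiplicative of the same `γ`-class, `μ_p(ℚ_w) = 1`; (iv) one non-split
multiplicative, the other good; **(iii′) `|j(W)|_w > 1` and `|j(W')|_w > 1` (multiplicative OR additive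
potentially multiplicative on either side, `w ∣ p` ALLOWED), same `γ`-class, `μ_p(ℚ_w) = 1`** (team n1011's
`TwistedKummer.h1Equiv_mem_selmerLocalKer_of_one_lt_valuation_j`). Dispatch to the tree's comparison lemmas
verbatim as in `Supersingular.h1Equiv_kummerMapTorsion_mem_selmerLocalKer_of_witness₆`, kind (v)/(vi) (good
at `p`, impossible on cell (M)) replaced by (iii′). Conditional on `hU` (kind (ii)), `hU2` (kinds
(iii)/(iii′)), `hF44` (kind (iv)). [cite: MazurRubin2015SelmerCompanions, Thm. 3.1 (iv)(a) and §6 Case 4]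
[cite: SilvermanATAEC1994, Ch. V Thm. 3.1, Lemma 5.2 (c), Thm. 5.3, Cor. 5.4]
[cite: Fisher2016Visualizing7, Thm. 4.4 (p. 106)] [cite: CremonaMazur2000, §3] -/
theorem h1Equiv_kummerMapTorsion_mem_selmerLocalKer_of_witness_potMult₆
    (hU : Silverman1994_thmV53_tateUniformisation.{0})
    (hU2 : Silverman1994_thmV53_corV54_tateUniformisation.{0})
    (hF44 : thm44_selmerLocalKer_iff_of_nonsplit_good)
    (hp2 : p ≠ 2) (θ : geomTorsion W' (p : ℤ) ≃+ geomTorsion W (p : ℤ))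
    (hθ : ∀ (σ : absoluteGaloisGroup ℚ) (P : geomTorsion W' (p : ℤ)), θ (σ • P) = σ • θ P)
    (hdiv' : ∀ Q : geomPoints W', ∃ R : geomPoints W', (p : ℤ) • R = Q) (P : W'.toAffine.Point)
    (w : HeightOneSpectrum (𝓞 ℚ))
    (hw : (∃ Q : (W'.baseChange (w.adicCompletion ℚ)).toAffine.Point,
        p • Q = WeierstrassCurve.Affine.Point.baseChange (W' := W') ℚ (w.adicCompletion ℚ) P) ∨
      ((p : 𝓞 ℚ) ∉ w.asIdeal ∧ Nat.card (nsmulAddMonoidHom p :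
          (W'.baseChange (w.adicCompletion ℚ)).toAffine.Point →+ _).ker = 1) ∨
      (W.HasSplitMultiplicativeReductionAt w ∧ W'.HasSplitMultiplicativeReductionAt w ∧
        Nat.card (nsmulAddMonoidHom p :
          (W.baseChange (w.adicCompletion ℚ)).toAffine.Point →+ _).ker ≤ p) ∨
      (W.HasMultiplicativeReductionAt w ∧ W'.HasMultiplicativeReductionAt w ∧
        (∃ r : w.adicCompletion ℚ, algebraMap ℚ (w.adicCompletion ℚ) (-(W.c₄ / W.c₆)) =
          r ^ 2 * algebraMap ℚ (w.adicCompletion ℚ) (-(W'.c₄ / W'.c₆))) ∧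
        (∀ ζ : w.adicCompletion ℚ, ζ ^ p = 1 → ζ = 1)) ∨
      ((W.HasMultiplicativeReductionAt w ∧ ¬ W.HasSplitMultiplicativeReductionAt w ∧
          W'.HasGoodReductionAt w) ∨
        (W.HasGoodReductionAt w ∧ W'.HasMultiplicativeReductionAt w ∧
          ¬ W'.HasSplitMultiplicativeReductionAt w)) ∨
      (1 < w.valuation ℚ W.j ∧ 1 < w.valuation ℚ W'.j ∧
        (∃ r : w.adicCompletion ℚ, algebraMap ℚ (w.adicCompletion ℚ) (-(W.c₄ / W.c₆)) =
          r ^ 2 * algebraMap ℚ (w.adicCompletion ℚ) (-(W'.c₄ / W'.c₆))) ∧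
        (∀ ζ : w.adicCompletion ℚ, ζ ^ p = 1 → ζ = 1))) :
    h1Equiv θ hθ (kummerMapTorsion W' (p : ℤ) hdiv' P) ∈ selmerLocalKer W (w.adicCompletion ℚ) (p : ℤ) := by
  have hpp : p.Prime := hp.out
  have hn : (p : ℤ) ≠ 0 := by exact_mod_cast hpp.ne_zero
  have hram : w.asIdeal.ramificationIdx ℤ < p - 1 := by
    have h1 := ramificationIdx_int_rat_eq_one w
    have h3 : 3 ≤ p := by
      rcases hpp.eq_two_or_odd' with h' | h'
      · exact absurd h' hp2
      · have := hpp.two_le; omega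
    omega
  -- the Kummer class of a rational point is Selmer for `W'` everywhere
  have hc : kummerMapTorsion W' (p : ℤ) hdiv' P ∈ selmerLocalKer W' (w.adicCompletion ℚ) (p : ℤ) :=
    kummerMapTorsion_mem_selmerLocalKer W' _ hdiv' _ P
  rcases hw with ⟨Q, hQ⟩ | ⟨hwp, hloc⟩ | ⟨hWw, hW'w, hcardw⟩ | ⟨hWw, hW'w, hγw, hμw⟩ | hkind |
      ⟨hjw, hj'w, hγw, hμw⟩
  · -- (a): a `p`-th root of `P` in `W'(ℚ_w)` — the class restricts to zero at `w`
    exact VisibleWitness.h1Equiv_kummerMapTorsion_mem_selmerLocalKer_of_exists_smul_eq W W' θ hθ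
      (w.adicCompletion ℚ) hn hdiv' P ⟨Q, by rw [natCast_zsmul]; exact hQ⟩
  · -- kind (i): `w ∤ p`, `W'(ℚ_w)[p] = 0`
    exact (relIndex_map_selmerLocalKer_eq_one_iff W W' θ hθ).mp
      (relIndex_map_selmerLocalKer_eq_one_of_card_torsion_eq_one W W' θ hθ hwp hloc) _ hc
  · -- kind (ii): both split multiplicative, `#W(ℚ_w)[p] ≤ p` (Tate uniformisation)
    exact W.h1Equiv_mem_selmerLocalKer_of_hasSplitMultiplicativeReductionAt w hU W' θ hθ hWw hW'w hcardw hc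
  · -- kind (iii): both multiplicative of the same `γ`-class, `μ_p(ℚ_w) = 1`
    exact W.h1Equiv_mem_selmerLocalKer_of_hasMultiplicativeReductionAt w hU2 hp2 W' θ hθ hWw hW'w hγw hμw
      hc
  · -- kind (iv): one non-split multiplicative, the other good (Fisher 2016 Thm. 4.4)
    exact selmerLocalKer_le_of_nonsplit_good W hF44 hp2 W' θ hθ w (Or.inr hram) hkind hc
  · -- kind (iii′): `|j|_w > 1` on both sides, same `γ`-class, `μ_p(ℚ_w) = 1` (`w ∣ p` allowed)
    exact TwistedKummer.h1Equiv_mem_selmerLocalKer_of_one_lt_valuation_j W w hU2 hp2 W' θ hθ hjw hj'w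
      hγw hμw hc

/-- Local dispatch, LEAN variant (three options; conditional on A41 `hU2` alone — no split-Tate `hU`, no
Fisher 2016): (a) a `p`-th root of `P` in `W'(ℚ_w)`, OR (i) `w ∤ p ∧ W'(ℚ_w)[p] = 0`, OR (iii′) `|j(W)|_w > 1`,
`|j(W')|_w > 1`, same `γ`-class, `μ_p(ℚ_w) = 1` (`w ∣ p` allowed — the additive place of an (M) pair).
[cite: MazurRubin2015SelmerCompanions, Thm. 3.1 (iv)(a) and §6 Case 4]
[cite: SilvermanATAEC1994, Ch. V Lemma 5.2 (c), Thm. 5.3, Cor. 5.4] [cite: CremonaMazur2000, §3] -/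
theorem h1Equiv_kummerMapTorsion_mem_selmerLocalKer_of_witness_potMult
    (hU2 : Silverman1994_thmV53_corV54_tateUniformisation.{0})
    (hp2 : p ≠ 2) (θ : geomTorsion W' (p : ℤ) ≃+ geomTorsion W (p : ℤ))
    (hθ : ∀ (σ : absoluteGaloisGroup ℚ) (P : geomTorsion W' (p : ℤ)), θ (σ • P) = σ • θ P)
    (hdiv' : ∀ Q : geomPoints W', ∃ R : geomPoints W', (p : ℤ) • R = Q) (P : W'.toAffine.Point)
    (w : HeightOneSpectrum (𝓞 ℚ))
    (hw : (∃ Q : (W'.baseChange (w.adicCompletion ℚ)).toAffine.Point,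
        p • Q = WeierstrassCurve.Affine.Point.baseChange (W' := W') ℚ (w.adicCompletion ℚ) P) ∨
      ((p : 𝓞 ℚ) ∉ w.asIdeal ∧ Nat.card (nsmulAddMonoidHom p :
          (W'.baseChange (w.adicCompletion ℚ)).toAffine.Point →+ _).ker = 1) ∨
      (1 < w.valuation ℚ W.j ∧ 1 < w.valuation ℚ W'.j ∧
        (∃ r : w.adicCompletion ℚ, algebraMap ℚ (w.adicCompletion ℚ) (-(W.c₄ / W.c₆)) =
          r ^ 2 * algebraMap ℚ (w.adicCompletion ℚ) (-(W'.c₄ / W'.c₆))) ∧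
        (∀ ζ : w.adicCompletion ℚ, ζ ^ p = 1 → ζ = 1))) :
    h1Equiv θ hθ (kummerMapTorsion W' (p : ℤ) hdiv' P) ∈ selmerLocalKer W (w.adicCompletion ℚ) (p : ℤ) := by
  have hpp : p.Prime := hp.out
  have hn : (p : ℤ) ≠ 0 := by exact_mod_cast hpp.ne_zero
  have hc : kummerMapTorsion W' (p : ℤ) hdiv' P ∈ selmerLocalKer W' (w.adicCompletion ℚ) (p : ℤ) :=
    kummerMapTorsion_mem_selmerLocalKer W' _ hdiv' _ P
  rcases hw with ⟨Q, hQ⟩ | ⟨hwp, hloc⟩ | ⟨hjw, hj'w, hγw, hμw⟩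
  · exact VisibleWitness.h1Equiv_kummerMapTorsion_mem_selmerLocalKer_of_exists_smul_eq W W' θ hθ
      (w.adicCompletion ℚ) hn hdiv' P ⟨Q, by rw [natCast_zsmul]; exact hQ⟩
  · exact (relIndex_map_selmerLocalKer_eq_one_iff W W' θ hθ).mp
      (relIndex_map_selmerLocalKer_eq_one_of_card_torsion_eq_one W W' θ hθ hwp hloc) _ hc
  · exact TwistedKummer.h1Equiv_mem_selmerLocalKer_of_one_lt_valuation_j W w hU2 hp2 W' θ hθ hjw hj'w
      hγw hμw hc

/-! ## §2 The visible element of `Ш(W)[p]` from a named witness -/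

/-- **The visible element of `Ш(E/ℚ)[p]` from a NAMED witness, with the potentially-multiplicative kind
(iii′)** (any `W/ℚ` with `E(ℚ)` finite of order prime to `p`): `θ : W'[p] ⥲ W[p]` a `Γ_ℚ`-isomorphism, `S` a
finite set of places off which both curves are good and `w ∤ p`, `P ∈ W'(ℚ) ∖ pW'(ℚ)`, and at every `w ∈ S`
one of the six options of `h1Equiv_kummerMapTorsion_mem_selmerLocalKer_of_witness_potMult₆`. Then `Ш(E/ℚ)`
has a non-zero element killed by `p` (team n1011's `VisibleWitness.exists_sha_ne_zero_of_congr_of_witness`).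
[cite: CremonaMazur2000, §3] [cite: AgasheStein2002, Lemma 3.6]
[cite: MazurRubin2015SelmerCompanions, Thm. 3.1 (iv)(a)] [cite: SilvermanATAEC1994, Ch. V Thm. 5.3, Cor. 5.4] -/
theorem exists_sha_ne_zero_of_congr_of_witness_potMult₆
    (hU : Silverman1994_thmV53_tateUniformisation.{0})
    (hU2 : Silverman1994_thmV53_corV54_tateUniformisation.{0})
    (hF44 : thm44_selmerLocalKer_iff_of_nonsplit_good)
    (hp2 : p ≠ 2) (θ : geomTorsion W' (p : ℤ) ≃+ geomTorsion W (p : ℤ))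
    (hθ : ∀ (σ : absoluteGaloisGroup ℚ) (P : geomTorsion W' (p : ℤ)), θ (σ • P) = σ • θ P)
    (S : Finset (HeightOneSpectrum (𝓞 ℚ)))
    (hS : ∀ w : HeightOneSpectrum (𝓞 ℚ), w ∉ S →
      W.HasGoodReductionAt w ∧ W'.HasGoodReductionAt w ∧ (p : 𝓞 ℚ) ∉ w.asIdeal)
    (hfin : Finite W.toAffine.Point) (hcop : (Nat.card W.toAffine.Point).Coprime p)
    (P : W'.toAffine.Point)
    (hP : P ∉ (zsmulAddGroupHom (p : ℤ) : W'.toAffine.Point →+ W'.toAffine.Point).range)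
    (hplaces : ∀ w ∈ S,
      (∃ Q : (W'.baseChange (w.adicCompletion ℚ)).toAffine.Point,
        p • Q = WeierstrassCurve.Affine.Point.baseChange (W' := W') ℚ (w.adicCompletion ℚ) P) ∨
      ((p : 𝓞 ℚ) ∉ w.asIdeal ∧ Nat.card (nsmulAddMonoidHom p :
          (W'.baseChange (w.adicCompletion ℚ)).toAffine.Point →+ _).ker = 1) ∨
      (W.HasSplitMultiplicativeReductionAt w ∧ W'.HasSplitMultiplicativeReductionAt w ∧
        Nat.card (nsmulAddMonoidHom p :
          (W.baseChange (w.adicCompletion ℚ)).toAffine.Point →+ _).ker ≤ p) ∨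
      (W.HasMultiplicativeReductionAt w ∧ W'.HasMultiplicativeReductionAt w ∧
        (∃ r : w.adicCompletion ℚ, algebraMap ℚ (w.adicCompletion ℚ) (-(W.c₄ / W.c₆)) =
          r ^ 2 * algebraMap ℚ (w.adicCompletion ℚ) (-(W'.c₄ / W'.c₆))) ∧
        (∀ ζ : w.adicCompletion ℚ, ζ ^ p = 1 → ζ = 1)) ∨
      ((W.HasMultiplicativeReductionAt w ∧ ¬ W.HasSplitMultiplicativeReductionAt w ∧
          W'.HasGoodReductionAt w) ∨
        (W.HasGoodReductionAt w ∧ W'.HasMultiplicativeReductionAt w ∧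
          ¬ W'.HasSplitMultiplicativeReductionAt w)) ∨
      (1 < w.valuation ℚ W.j ∧ 1 < w.valuation ℚ W'.j ∧
        (∃ r : w.adicCompletion ℚ, algebraMap ℚ (w.adicCompletion ℚ) (-(W.c₄ / W.c₆)) =
          r ^ 2 * algebraMap ℚ (w.adicCompletion ℚ) (-(W'.c₄ / W'.c₆))) ∧
        (∀ ζ : w.adicCompletion ℚ, ζ ^ p = 1 → ζ = 1))) :
    ∃ c : W.sha, c ≠ 0 ∧ p • c = 0 := by
  have hpp : p.Prime := hp.out
  have hn : (p : ℤ) ≠ 0 := by exact_mod_cast hpp.ne_zero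
  haveI := hfin
  have hdiv' : ∀ Q : geomPoints W', ∃ R : geomPoints W', (p : ℤ) • R = Q :=
    W'.zsmul_geomPoints_surjective_holds hn
  have hE : (zsmulAddGroupHom (p : ℤ) : W.toAffine.Point →+ W.toAffine.Point).range = ⊤ := by
    rw [← AddSubgroup.index_eq_one]
    exact index_range_zsmul_eq_one_of_coprime hcop
  -- the tree's witness theorem carries the classical `DecidableEq`; over `ℚ` the binders here carry
  -- `instDecidableEqRat` (the instances are equal, `Subsingleton`): `convert`.
  exact VisibleWitness.exists_sha_ne_zero_of_congr_of_witness W W' hp2 θ hθ S hS hdiv' (by convert hE) P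
    (by convert hP) fun w hw ↦
    h1Equiv_kummerMapTorsion_mem_selmerLocalKer_of_witness_potMult₆ hU hU2 hF44 hp2 θ hθ hdiv' P w (hplaces w hw)

/-- **The visible element of `Ш(E/ℚ)[p]` from a NAMED witness, lean variant** (options (a) / (i) / (iii′)
only; conditional on A41 `hU2` alone). [cite: CremonaMazur2000, §3] [cite: AgasheStein2002, Lemma 3.6]
[cite: MazurRubin2015SelmerCompanions, Thm. 3.1 (iv)(a)] [cite: SilvermanATAEC1994, Ch. V Thm. 5.3, Cor. 5.4] -/
theorem exists_sha_ne_zero_of_congr_of_witness_potMult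
    (hU2 : Silverman1994_thmV53_corV54_tateUniformisation.{0})
    (hp2 : p ≠ 2) (θ : geomTorsion W' (p : ℤ) ≃+ geomTorsion W (p : ℤ))
    (hθ : ∀ (σ : absoluteGaloisGroup ℚ) (P : geomTorsion W' (p : ℤ)), θ (σ • P) = σ • θ P)
    (S : Finset (HeightOneSpectrum (𝓞 ℚ)))
    (hS : ∀ w : HeightOneSpectrum (𝓞 ℚ), w ∉ S →
      W.HasGoodReductionAt w ∧ W'.HasGoodReductionAt w ∧ (p : 𝓞 ℚ) ∉ w.asIdeal)
    (hfin : Finite W.toAffine.Point) (hcop : (Nat.card W.toAffine.Point).Coprime p)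
    (P : W'.toAffine.Point)
    (hP : P ∉ (zsmulAddGroupHom (p : ℤ) : W'.toAffine.Point →+ W'.toAffine.Point).range)
    (hplaces : ∀ w ∈ S,
      (∃ Q : (W'.baseChange (w.adicCompletion ℚ)).toAffine.Point,
        p • Q = WeierstrassCurve.Affine.Point.baseChange (W' := W') ℚ (w.adicCompletion ℚ) P) ∨
      ((p : 𝓞 ℚ) ∉ w.asIdeal ∧ Nat.card (nsmulAddMonoidHom p :
          (W'.baseChange (w.adicCompletion ℚ)).toAffine.Point →+ _).ker = 1) ∨
      (1 < w.valuation ℚ W.j ∧ 1 < w.valuation ℚ W'.j ∧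
        (∃ r : w.adicCompletion ℚ, algebraMap ℚ (w.adicCompletion ℚ) (-(W.c₄ / W.c₆)) =
          r ^ 2 * algebraMap ℚ (w.adicCompletion ℚ) (-(W'.c₄ / W'.c₆))) ∧
        (∀ ζ : w.adicCompletion ℚ, ζ ^ p = 1 → ζ = 1))) :
    ∃ c : W.sha, c ≠ 0 ∧ p • c = 0 := by
  have hpp : p.Prime := hp.out
  have hn : (p : ℤ) ≠ 0 := by exact_mod_cast hpp.ne_zero
  haveI := hfin
  have hdiv' : ∀ Q : geomPoints W', ∃ R : geomPoints W', (p : ℤ) • R = Q :=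
    W'.zsmul_geomPoints_surjective_holds hn
  have hE : (zsmulAddGroupHom (p : ℤ) : W.toAffine.Point →+ W.toAffine.Point).range = ⊤ := by
    rw [← AddSubgroup.index_eq_one]
    exact index_range_zsmul_eq_one_of_coprime hcop
  exact VisibleWitness.exists_sha_ne_zero_of_congr_of_witness W W' hp2 θ hθ S hS hdiv' (by convert hE) P
    (by convert hP) fun w hw ↦
    h1Equiv_kummerMapTorsion_mem_selmerLocalKer_of_witness_potMult hU2 hp2 θ hθ hdiv' P w (hplaces w hw)

end Witness


end Summit.BirchSwinnertonDyer.BirchSwinnertonDyer.Theorems.AdditiveBranchIMCMultLowerCompanion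

end
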